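import Summits.CriticalPhenomena.PercolationContinuityZ3.Theorems.PercNearOneGluingNoHeavyLowerTailSahiMixtureMonotone
import Literature.Combinatorics.Sahi2008.ProductOfChains
import HarnessLib

/-!
# Every OR-coin cell of a monotone mixture of product measures is nonnegative, at every order

Support file of the one-cut programme (crux `NoHeavyLowerTail`, stmt-CriticalPhenomena-4575; cell `prim-masterthm`, seat P3, gen 15;
`run/shared/lean/prim/prim-masterthm/prim-masterthm-p3/HIERARCHY.md` §23; memo
`run/shared/lean/prim/prim-masterthm/FROM-prim-masterthm-p3-g15-MONOTONE-MIXTURES.md` §3).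

CONTEXT.  The H-MIX ladder (gens 8–14): for a law in the hereditary class `𝒦_n`, OR an independent coin `H` of bias `h` into the members of a set
`G`; the cell `E_n((A_i ∪ H)_{i∈G}, (A_j)_{j∉G})` is a theorem for `|G| ≤ 1` (every `n`), `|G| = n−1` (`n ≤ 6`), `|G| = n` (`n ≤ 6` in Lean), and FALSE
for `2 ≤ |G| ≤ n−2`, `n ≥ 5` (`hmixClosure_fails`).  THIS FILE: on the sub-class of laws with CHAIN MOMENTS (`…SahiMixtureChainMoments`: events
conditionally independent given a latent level with co-monotone conditional probabilities — monotone mixtures of product measures, which are MTP₂ and lie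
in `𝒦_n` for every `n`), EVERY cell is `≥ 0`, for EVERY `n` and EVERY `G`:
**`sahiE_orCoin_cell_nonneg_of_chainMoments`**, instance **`sahiE_orCoin_cell_nonneg_of_monotoneMixture`**.
PROOF.  Conditionally on (level `l`, coin `c`) the OR-ed events are independent with probabilities `φ_j(l,c) = 1` if `j ∈ G` and `c`, else `y_{l,j}` —
monotone on the PRODUCT OF TWO CHAINS `Fin L × Bool` carrying the PRODUCT weight `w ⊗ coin(h)`.  By moment transfer (`sahiE_congr_of_moments`) the cell equals
`E_m^{w ⊗ coin(h)}(φ)`, which is `≥ 0` by Lieb–Sahi's Theorem 3.7 for every product measure on a product of two chains (the tree's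
`ProductChains.sahiPositive_prodWeight_linearOrder`).  (Bernstein positivity of these cells — true in all 636 sampled cells for `n ≤ 8`, memo §5 — is proved
only for `|G| ∈ {0, n}` (`…ChainBernstein`, `…ChainBernsteinTwo`) and is affine hence immediate for `|G| = 1`; open otherwise.)
HONEST FRAMING: nothing here asserts (M⁺-k) or `C_k` for `k ≥ 3`; general increasing events of these laws are not covered. Everything PROVED, standard axioms.
[this work]
-/

noncomputable section

open scoped Classical

namespace Summit.CriticalPhenomena.PercolationContinuityZ3.Theorems

open Finset Function
open Literature.Combinatorics.Sahi2008
open Literature.Probability.Percolation.DecisionTree (ind ind_of_mem ind_of_not_mem ind_nonneg)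

namespace SahiMixture

section Cells

variable {α : Type*} [Fintype α] {L n : ℕ}

/-- A product over `Fin k` of terms that are `1` off a Boolean predicate is the product over the filter, re-indexed by `Fin` of its cardinality
(plumbing for restricting the chain-moment hypothesis to the non-OR-ed slots). [folklore] -/
theorem prod_bif_eq_prod_equivFin {k : ℕ} (p : Fin k → Bool) (X : Fin k → ℝ) :
    ∏ r, (bif p r then (1 : ℝ) else X r)
      = ∏ i : Fin (Finset.univ.filter fun r => p r = false).card,
          X (((Finset.univ.filter fun r => p r = false).equivFin.symm i : {x // x ∈ Finset.univ.filter fun r => p r = false}) : Fin k) := by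
  set S : Finset (Fin k) := Finset.univ.filter fun r => p r = false with hS
  have h1 : ∏ r, (bif p r then (1 : ℝ) else X r) = ∏ r ∈ S, X r := by
    rw [hS, Finset.prod_filter]
    refine Finset.prod_congr rfl fun r _ => ?_
    cases p r <;> simp
  rw [h1, ← Finset.prod_coe_sort S X]
  exact (Fintype.prod_equiv S.equivFin.symm (fun i => X ((S.equivFin.symm i : S) : Fin k)) (fun x => X (x : Fin k))
    (fun i => rfl)).symm

/-- Moments of a general OR-coin cell family: `E[Π_r 1_{A_{e r} ∪ (H if g(e r))}] = (1−h)·E[Π_r 1_{A_{e r}}] + h·E[Π_{r : ¬ g(e r)} 1_{A_{e r}}]`. [this work] -/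
theorem ex_coinWeight_prod_ind_orCoin_cell (μ : α → ℝ) (A : Fin n → Set α) (g : Fin n → Bool) (h : ℝ) {k : ℕ} (e : Fin k → Fin n) :
    ex (coinWeight μ h) (∏ r, ind (orCoin (A (e r)) (g (e r))))
      = (1 - h) * ex μ (∏ r, ind (A (e r))) + h * ex μ (fun a => ∏ r, (bif g (e r) then (1 : ℝ) else ind (A (e r)) a)) := by
  rw [ex_coinWeight]
  have hf : (fun a : α => (∏ r, ind (orCoin (A (e r)) (g (e r)))) (a, false)) = ∏ r, ind (A (e r)) := by
    funext a
    rw [Finset.prod_apply, Finset.prod_apply]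
    exact Finset.prod_congr rfl fun r _ => ind_orCoin_false _ _ _
  have ht : (fun a : α => (∏ r, ind (orCoin (A (e r)) (g (e r)))) (a, true)) = fun a => ∏ r, (bif g (e r) then (1 : ℝ) else ind (A (e r)) a) := by
    funext a
    rw [Finset.prod_apply]
    exact Finset.prod_congr rfl fun r _ => ind_orCoin_true _ _ _
  rw [hf, ht]

/-- **Every OR-coin cell is nonnegative under chain moments, at every order.**  Events `A_0,…,A_{n−1}` with chain moments
`E[Π_r 1_{A_{e r}}] = Σ_l w_l Π_r y_{l,e r}` (`w ≥ 0` of mass `1`, `0 ≤ y ≤ 1`, `y_{·,i}` nondecreasing); `h ∈ [0,1]`; any `m`, any injective `s : Fin m → Fin n` and ANY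
choice `g : Fin m → Bool` of the slots into which the coin is OR-ed:  `E_m(μ ⊗ coin(h); (1_{A_{s j} ∪ (H if g j)})_j) ≥ 0`.  Moment transfer to the product of two chains
`Fin L × Bool` with the product weight `w ⊗ coin(h)`, then Lieb–Sahi's Theorem 3.7 (`ProductChains.sahiPositive_prodWeight_linearOrder`). [this work] -/
theorem sahiE_orCoin_cell_nonneg_of_chainMoments (μ : α → ℝ) (A : Fin n → Set α)
    (w : Fin L → ℝ) (hw0 : ∀ l, 0 ≤ w l) (hw1 : ∑ l, w l = 1)
    (y : Fin L → Fin n → ℝ) (hy0 : ∀ l i, 0 ≤ y l i) (hy1 : ∀ l i, y l i ≤ 1) (hmono : ∀ i, Monotone (fun l => y l i))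
    (hmom : ∀ (k : ℕ) (e : Fin k → Fin n), Function.Injective e →
      ex μ (∏ r, ind (A (e r))) = ∑ l, w l * ∏ r, y l (e r))
    {h : ℝ} (h0 : 0 ≤ h) (h1 : h ≤ 1) {m : ℕ} (s : Fin m → Fin n) (hs : Function.Injective s) (g : Fin m → Bool) :
    0 ≤ sahiE (coinWeight μ h) m (fun j => ind (orCoin (A (s j)) (g j))) := by
  -- `Fin L` is nonempty since the weights sum to one
  have hL : Nonempty (Fin L) := by
    rcases Nat.eq_zero_or_pos L with hL0 | hLpos
    · subst hL0; simp at hw1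
    · exact ⟨⟨0, hLpos⟩⟩
  -- latent space `Fin L × Bool`, product weight `w ⊗ coin(h)`, functions `φ j (l, c) = 1` if `g j ∧ c`, else `y l (s j)`
  let W : Fin L × Bool → ℝ := fun p => w p.1 * (fun c : Bool => bif c then h else 1 - h) p.2
  let φ : Fin m → Fin L × Bool → ℝ := fun j p => bif (g j && p.2) then 1 else y p.1 (s j)
  have hW : SahiPositive W m :=
    ProductChains.sahiPositive_prodWeight_linearOrder w (fun c : Bool => bif c then h else 1 - h) hw0 hw1
      (fun c => by cases c <;> simp [h0, sub_nonneg.2 h1]) (by simp) m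
  have hφ0 : ∀ j p, 0 ≤ φ j p := by
    intro j p; simp only [φ]; cases (g j && p.2) <;> simp [hy0]
  have hφm : ∀ j, Monotone (φ j) := by
    intro j p q hpq
    have hl : p.1 ≤ q.1 := hpq.1
    have hc : p.2 ≤ q.2 := hpq.2
    simp only [φ]
    cases hgj : g j
    · simpa using hmono (s j) hl
    · cases hp : p.2 <;> cases hq : q.2
      · simpa using hmono (s j) hl
      · simpa using hy1 p.1 (s j)
      · rw [hp, hq] at hc; exact absurd hc (by decide)
      · simp
  rw [sahiE_congr_of_moments (coinWeight μ h) W (fun j => ind (orCoin (A (s j)) (g j))) φ ?_]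
  · exact hW φ hφ0 hφm
  · intro k e he
    rw [show (∏ r, ind (orCoin (A (s (e r))) (g (e r)))) = ∏ r, ind (orCoin ((A ∘ s) (e r)) (g (e r))) from rfl,
      ex_coinWeight_prod_ind_orCoin_cell μ (A ∘ s) g h e,
      show (∏ r, ind ((A ∘ s) (e r))) = ∏ r, ind (A ((s ∘ e) r)) from rfl, hmom k (s ∘ e) (hs.comp he)]
    -- the `h`-part: restrict the chain-moment hypothesis to the non-OR-ed slots
    have hrest : ex μ (fun a => ∏ r, (bif g (e r) then (1 : ℝ) else ind ((A ∘ s) (e r)) a))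
        = ∑ l, w l * ∏ r, (bif g (e r) then (1 : ℝ) else y l (s (e r))) := by
      set S : Finset (Fin k) := Finset.univ.filter fun r => (fun r => g (e r)) r = false with hS
      let e' : Fin S.card → Fin n := fun i => s (e ((S.equivFin.symm i : S) : Fin k))
      have he' : Function.Injective e' := by
        intro i j hij
        have := (hs.comp he) hij
        exact S.equivFin.symm.injective (Subtype.ext this)
      have key := hmom S.card e' he'
      have lhs : (fun a => ∏ r, (bif g (e r) then (1 : ℝ) else ind ((A ∘ s) (e r)) a)) = ∏ i, ind (A (e' i)) := by
        funext a
        rw [Finset.prod_apply, prod_bif_eq_prod_equivFin (fun r => g (e r)) (fun r => ind ((A ∘ s) (e r)) a)]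
        rfl
      rw [lhs, key]
      refine Finset.sum_congr rfl fun l _ => ?_
      rw [prod_bif_eq_prod_equivFin (fun r => g (e r)) (fun r => y l (s (e r)))]
    rw [hrest, ex_def, Fintype.sum_prod_type]
    simp only [W, φ, Fintype.sum_bool, Finset.prod_apply, Function.comp, Bool.and_true, Bool.and_false, cond_true, cond_false,
      Finset.mul_sum, ← Finset.sum_add_distrib]
    refine Finset.sum_congr rfl fun l _ => ?_
    ring

/-- **Instance: every OR-coin cell of a monotone mixture of product measures is nonnegative, at every order** — in particular all the cells
`2 ≤ |G| ≤ n − 2` that FAIL on the full hereditary class (`hmixClosure_fails`) hold on this MTP₂ sub-class. [this work] -/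
theorem sahiE_orCoin_cell_nonneg_of_monotoneMixture {ι : Type*} [Fintype ι] [DecidableEq ι]
    (w : Fin L → ℝ) (hw0 : ∀ l, 0 ≤ w l) (hw1 : ∑ l, w l = 1)
    (y : Fin L → ι → ℝ) (hy0 : ∀ l i, 0 ≤ y l i) (hy1 : ∀ l i, y l i ≤ 1) (hmono : ∀ i, Monotone (fun l => y l i))
    {h : ℝ} (h0 : 0 ≤ h) (h1 : h ≤ 1) {m : ℕ} (e : Fin m → ι) (he : Function.Injective e) (g : Fin m → Bool) :
    0 ≤ sahiE (coinWeight (mixProdWeight w y) h) m (fun j => ind (orCoin (bitEv (e j)) (g j))) :=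
  sahiE_orCoin_cell_nonneg_of_chainMoments (mixProdWeight w y) (fun j => bitEv (e j)) w hw0 hw1 (fun l j => y l (e j))
    (fun l j => hy0 l (e j)) (fun l j => hy1 l (e j)) (fun j => hmono (e j))
    (fun _ e' he' => ex_mixProdWeight_prod_ind w y (e ∘ e') (he.comp he')) h0 h1 id injective_id g

end Cells

end SahiMixture

end Summit.CriticalPhenomena.PercolationContinuityZ3.Theorems

end
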